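import Summits.QuantumFields.YangMills.Theorems.UV3PinnedTransportStepDirect
import Summits.QuantumFields.YangMills.Theorems.UV3PinnedRestrictedPin
import Summits.QuantumFields.YangMills.Theorems.AlphaInputsT3ACv3Step
import HarnessLib

/-!
# R3 (cell `ym3-torus`, YM₃ on T³ — a ladder RUNG, NOT d = 4, NOT the Clay problem), UV3-node side of `stub_pinnedStep` (R-19936-S), v3 currency —
# **THE RESTRICTED (41) ABOVE A PIN FOR THE v3 (α) PACKAGE'S TOWER (WINDOWED PINNED WEIGHTS `wtP`)**: the v3 twin of ✓`UV3PinnedRestrictedStep` /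
# ✓`UV3PinnedRestrictedPin` — the a.e. induction `PinnedStep.ineq41_pinned_windowed_ae_of_expo` (`AlphaInputsT3ACv3Induction`) re-threaded with the
# history sum RESTRICTED to a covering-closed family; rows `Fibre55WinAC`, the exponent step `hexpo` and the data rows as hypotheses EXACTLY as there

Seat `ym3-torus-px8` g11.  THEOREMS ONLY (0 `def`, 0 `sorry`); `--supports stmt-QuantumFields-19936 --as helper`; count-neutral (★★OWNER WORD 58 (e): the v3 reading is the
residual hJ's honest home).  Ingredients: ✓`UV3PinnedTransportStepDirect.transport41_le_sum_ae_direct_of_ae_le` (dominated direct step), the v3 weights∕masses∕cover of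
`AlphaInputsT3ACv3Step` (`wtP`, `massP`, `MassesPAC.massRecP_cover`, `integrable_mul_exp41`), the pin family of ✓`UV3PinnedRestrictedPin` (`pinFamily_snoc_iff`,
`mem_pinFamily_snoc_of_pin`).

WHAT IS PROVED (ns `…Theorems.UV3PinnedRestrictedStepV3`), at the v3 objects (`𝔎 X 𝔖 win`, tower `towerOfAC 𝔎 X 𝔖`):
* §1 ★★★ `transport_restricted_le_sum41_ae` — ONE step: `σ ≥ 0` integrable with `σ ≤ᵐ Σ_h m₀(h)·e^{(41)_k}` for `0 ≤ m₀ ≤ wtP_k`, family `H₁ ∋` the covering history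
  of every `(h,U)` with `m₀(h,U) ≠ 0` ⟹ `T_k σ ≤ᵐ Σ_{h′ ∈ H₁} wtP_{k+1}(h′)·e^{(41)_{k+1}}`.
* §2 ★★★ `restricted41_above` — the induction above a base level for a family `Ha` closed under the covering, `σ_{k+1} =ᵐ T_k σ_k`.
* §3 ★★★ `restricted41_succ_of_pin` — the pin level from `σ ≤ᵐ 𝟙_A·ρ_s` and the v3 (41)_s `ρ_s ≤ᵐ Σ_h wtP_s·e^{(41)_s}` (hypothesis `h41s`; the package gives it:
  `PkgCoreV3.ineq41P_ae`).
* §4 ★★★ `pinned41_above` — §3 + §2 for the explicit family «`a ∈ h(s)` ∨ `¬ plaqCover a ⊆ Ω_s(h↾s)`», `θ ≥ eps1Of s`.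

HONEST SCOPE.  Bookkeeping; every (α)∕(β) row (`Fibre55WinAC`, `hexpo`, data rows, `h41s`) is a hypothesis; the Thm-1-side pinned leaf (S-ii), `stub_pinnedStep`, `hP′`, `HistoryTailL`
(19936) NOT proved; nothing continuum ∕ OS ∕ mass-gap ∕ Clay.
References: T. Bałaban, CMP **102** (1985) 255–275 [Balaban1985UV3] ((7)–(8) pp. 257–258, (40)–(41) p. 266, (48)–(49) pp. 267–268, (55) p. 269, (58) p. 270).
-/

set_option autoImplicit false

noncomputable section

namespace Summit.QuantumFields.YangMills.Theorems.UV3PinnedRestrictedStepV3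

open MeasureTheory
open Literature.MathematicalPhysics.QuantumFieldTheory.Balaban1983to89
open Literature.MathematicalPhysics.QuantumFieldTheory.Balaban1983to89.AveragingRT (rnTransport)
open Literature.MathematicalPhysics.QuantumFieldTheory.Balaban1985CMP102
open Literature.MathematicalPhysics.QuantumFieldTheory.Balaban1985CMP102.Setting
open Summit.QuantumFields.Balaban3D.Carriers
open Summit.QuantumFields.Balaban3D.Proofs.Inputs (LaneConsts)
open Summit.QuantumFields.Balaban3D.Proofs.TowerAC
open Summit.QuantumFields.Balaban3D.Proofs.StandardAC
open Summit.QuantumFields.Balaban3D.Proofs.InputsAC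
open Summit.QuantumFields.Balaban3D.Proofs.Bound55Masses (chiB chiB_nonneg chiB_le_one measurable_chiB measurable_stepWeight largeSet
  stepWeight_mul_chiB_cover measurable_dev)
open Summit.QuantumFields.Balaban3D.Proofs.MassesPAC
open Summit.QuantumFields.YangMills.Theorems.PinnedStep (wtP massP wtP_succ wtP_nonneg_le wtP_eq_zero_of_not_admissible measurable_wtP
  integrable_wtP_and_integral_le Fibre55WinAC integrable_mul_exp41)
open Summit.QuantumFields.YangMills.Theorems.UV3PinnedTransportStepDirect (transport41_le_sum_ae_direct_of_ae_le)
open Summit.QuantumFields.YangMills.Theorems.UV3PinnedRestrictedStep (pinFamily_snoc_iff mem_pinFamily_snoc_of_pin)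

variable {L : ℕ} (𝔎 : LaneConsts L) {S : Scales L} {G : Type} [GaugeGroup G] [MeasurableSpace G] [HaarData G] [RegularGaugeGroup G]
  {E : Type} [NormedAddCommGroup E] [NormedSpace ℂ E]
  (X : ExternalInputsAC S G) (𝔖 : ∀ k, StepSeries S G E (nblkOf S 𝔎.carrier k) k)
  (win : (k : ℕ) → Hist S.P (k + 1) → Set (GaugeField S.P (k + 1) G))

/-! ## §1 One restricted step with the (41)_{k+1} exponent -/

open Classical in
/-- ★★★ **THE RESTRICTED STEP FOR THE v3 TOWER.**  Step `k` with `k + 1 ≤ K`; measurable windows; the row `Fibre55WinAC` at every new history; the per-history exponent step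
`hexpo`; the data rows at level `k`; a SMALL mass `0 ≤ m₀ ≤ wtP_k` with integrable (41)_k summands; a finite family `H₁` of new histories containing the lane's covering
history `h ⌢ largeSet(h,U)` wherever `m₀(h,U) ≠ 0`; a non-negative integrable `σ` a.e. below `Σ_h m₀(h)·e^{(41)_k exponent}`.  THEN
`T_k σ ≤ Σ_{h′ ∈ H₁} wtP_{k+1}(h′)·exp[−mainT_{k+1} + Pint_{k+1} − E_{k+1} + Zterm_{k+1} + Rm_{k+1}]` `dV`-a.e.
[cite: Balaban1985UV3, (41) p.266 + (48)-(49) pp.267-268 + (55) p.269 + (58) p.270] -/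
theorem transport_restricted_le_sum41_ae (hwin : ∀ k h', MeasurableSet (win k h')) (k : ℕ) (hk : k + 1 ≤ S.K)
    (hrow : ∀ h' : Hist S.P (k + 1), Fibre55WinAC 𝔎 X 𝔖 win k h')
    (hexpo : ∀ (hh : Hist S.P (k + 1)) (U : GaugeField S.P (k + 1) G),
      -((towerOfAC 𝔎 X 𝔖).mainT (k + 1) hh U) - (towerOfAC 𝔎 X 𝔖).Ecst k
          + ((piecesAC 𝔎 X 𝔖 k).logσ₀ + (piecesAC 𝔎 X 𝔖 k).dg * Real.log ((towerOfAC 𝔎 X 𝔖).g k)) * (piecesAC 𝔎 X 𝔖 k).starB hh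
          + (piecesAC 𝔎 X 𝔖 k).logZU hh U + (piecesAC 𝔎 X 𝔖 k).Pold hh U
          + (towerOfAC 𝔎 X 𝔖).Zterm k ((piecesAC 𝔎 X 𝔖 k).proj hh) + (towerOfAC 𝔎 X 𝔖).Rm k + (piecesAC 𝔎 X 𝔖 k).logFl hh U ≤
        -((towerOfAC 𝔎 X 𝔖).mainT (k + 1) hh U) + (towerOfAC 𝔎 X 𝔖).Pint (k + 1) hh U - (towerOfAC 𝔎 X 𝔖).Ecst (k + 1)
          + (towerOfAC 𝔎 X 𝔖).Zterm (k + 1) hh + (towerOfAC 𝔎 X 𝔖).Rm (k + 1))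
    (hU : ∀ h : Hist S.P k, Measurable (X.UkH k h))
    (hPm : ∀ h : Hist S.P k, Measurable ((inputOfAC 𝔎 X 𝔖).Pint k h))
    (hPb : ∃ cP : ℝ, ∀ (h : Hist S.P k) (U : GaugeField S.P k G), (inputOfAC 𝔎 X 𝔖).Pint k h U ≤ cP)
    (m₀ : Hist S.P k → Density S.P k G) (hm₀m : ∀ h, Measurable (m₀ h)) (hm₀0 : ∀ h U, 0 ≤ m₀ h U)
    (hle : ∀ h U, m₀ h U ≤ wtP 𝔎 X win k h U)
    (H₁ : Finset (Hist S.P (k + 1)))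
    (hcoverIn : ∀ (h : Hist S.P k) (U : GaugeField S.P k G), m₀ h U ≠ 0 →
      Hist.snoc h (largeSet 𝔎.carrier.M₁ (rcolOf S 𝔎.carrier) (eps1Of S 𝔎.carrier) k h U) ∈ H₁)
    (σ : Density S.P k G) (hσ0 : ∀ U, 0 ≤ σ U) (hσi : Integrable σ (fieldMeasure S.P k G))
    (hσ : σ ≤ᵐ[fieldMeasure S.P k G] fun U => ∑ h : Hist S.P k, m₀ h U *
      Real.exp (-((towerOfAC 𝔎 X 𝔖).mainT k h U) + (towerOfAC 𝔎 X 𝔖).Pint k h U - (towerOfAC 𝔎 X 𝔖).Ecst k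
        + (towerOfAC 𝔎 X 𝔖).Zterm k h + (towerOfAC 𝔎 X 𝔖).Rm k)) :
    rnTransport (X.av k).avg σ ≤ᵐ[fieldMeasure S.P (k + 1) G] fun V =>
      ∑ h' ∈ H₁, wtP 𝔎 X win (k + 1) h' V *
        Real.exp (-((towerOfAC 𝔎 X 𝔖).mainT (k + 1) h' V) + (towerOfAC 𝔎 X 𝔖).Pint (k + 1) h' V - (towerOfAC 𝔎 X 𝔖).Ecst (k + 1)
          + (towerOfAC 𝔎 X 𝔖).Zterm (k + 1) h' + (towerOfAC 𝔎 X 𝔖).Rm (k + 1)) := by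
  obtain ⟨cP, hcP⟩ := hPb
  have hLS := Summit.QuantumFields.Balaban3D.Proofs.AlphaBound55.eps1Of_le_epsSOf k 𝔎.carrier 𝔎.F.b₀_nonneg 𝔎.F.p₀_pos.le
    (show k ≤ S.K by omega)
  -- integrability of the summands for the weights `wtP` and for the small mass `m₀ ≤ wtP`
  have hintW : ∀ h : Hist S.P k, Integrable (fun U => wtP 𝔎 X win k h U * Real.exp (-((towerOfAC 𝔎 X 𝔖).mainT k h U)
        + (towerOfAC 𝔎 X 𝔖).Pint k h U - (towerOfAC 𝔎 X 𝔖).Ecst k + (towerOfAC 𝔎 X 𝔖).Zterm k h + (towerOfAC 𝔎 X 𝔖).Rm k)) (fieldMeasure S.P k G) :=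
    fun h => integrable_mul_exp41 𝔎 X 𝔖 k hU hPm cP hcP h (integrable_wtP_and_integral_le 𝔎 X win hwin k h).1
  have hm₀i : ∀ h : Hist S.P k, Integrable (m₀ h) (fieldMeasure S.P k G) := fun h =>
    (integrable_wtP_and_integral_le 𝔎 X win hwin k h).1.mono' (hm₀m h).aestronglyMeasurable (ae_of_all _ fun U => by
      rw [Real.norm_eq_abs, abs_of_nonneg (hm₀0 h U)]; exact hle h U)
  have hint₀ : ∀ h : Hist S.P k, Integrable (fun U => m₀ h U * Real.exp (-((towerOfAC 𝔎 X 𝔖).mainT k h U)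
        + (towerOfAC 𝔎 X 𝔖).Pint k h U - (towerOfAC 𝔎 X 𝔖).Ecst k + (towerOfAC 𝔎 X 𝔖).Zterm k h + (towerOfAC 𝔎 X 𝔖).Rm k)) (fieldMeasure S.P k G) :=
    fun h => integrable_mul_exp41 𝔎 X 𝔖 k hU hPm cP hcP h (hm₀i h)
  -- the direct rows over the subtype of `H₁`, with the right-hand side regrouped as `massP · (𝟙[win]·e^{(55)})`
  have hdirect : ∀ h' : ↥H₁,
      (rnTransport (X.av k).avg (fun U =>
        stepWeight 𝔎.carrier.M₁ (rcolOf S 𝔎.carrier) (eps1Of S 𝔎.carrier) (epsSOf S 𝔎.carrier) k h'.1 U *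
          chiB 𝔎.carrier.M₁ (rcolOf S 𝔎.carrier) (eps1Of S 𝔎.carrier) k h'.1 U *
          (wtP 𝔎 X win k h'.1.proj U * Real.exp (-((towerOfAC 𝔎 X 𝔖).mainT k h'.1.proj U) + (towerOfAC 𝔎 X 𝔖).Pint k h'.1.proj U
            - (towerOfAC 𝔎 X 𝔖).Ecst k + (towerOfAC 𝔎 X 𝔖).Zterm k h'.1.proj + (towerOfAC 𝔎 X 𝔖).Rm k))))
      ≤ᵐ[fieldMeasure S.P (k + 1) G] fun V => massP 𝔎 X (k + 1) h'.1 V *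
        ((win k h'.1).indicator (fun _ => (1 : ℝ)) V * Real.exp (-((towerOfAC 𝔎 X 𝔖).mainT (k + 1) h'.1 V) - (towerOfAC 𝔎 X 𝔖).Ecst k
            + ((piecesAC 𝔎 X 𝔖 k).logσ₀ + (piecesAC 𝔎 X 𝔖 k).dg * Real.log ((towerOfAC 𝔎 X 𝔖).g k)) * (piecesAC 𝔎 X 𝔖 k).starB h'.1
            + (piecesAC 𝔎 X 𝔖 k).logZU h'.1 V + (piecesAC 𝔎 X 𝔖 k).Pold h'.1 V
            + (towerOfAC 𝔎 X 𝔖).Zterm k ((piecesAC 𝔎 X 𝔖 k).proj h'.1) + (towerOfAC 𝔎 X 𝔖).Rm k + (piecesAC 𝔎 X 𝔖 k).logFl h'.1 V)) := by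
    intro h'
    filter_upwards [hrow h'.1] with V h
    exact h.trans (le_of_eq (by ring))
  have key := transport41_le_sum_ae_direct_of_ae_le (avg := (X.av k).avg) (X.av_ac k)
    (H₀ := Hist S.P k) (H₁ := ↥H₁) (fun h' => h'.1.proj) σ hσi hσ0 m₀ (wtP 𝔎 X win k)
    (fun h U => -((towerOfAC 𝔎 X 𝔖).mainT k h U) + (towerOfAC 𝔎 X 𝔖).Pint k h U - (towerOfAC 𝔎 X 𝔖).Ecst k
        + (towerOfAC 𝔎 X 𝔖).Zterm k h + (towerOfAC 𝔎 X 𝔖).Rm k)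
    (fun h' => stepWeight 𝔎.carrier.M₁ (rcolOf S 𝔎.carrier) (eps1Of S 𝔎.carrier) (epsSOf S 𝔎.carrier) k h'.1)
    (fun h' => chiB 𝔎.carrier.M₁ (rcolOf S 𝔎.carrier) (eps1Of S 𝔎.carrier) k h'.1)
    (fun h' V => massP 𝔎 X (k + 1) h'.1 V)
    (fun h' V => (win k h'.1).indicator (fun _ => (1 : ℝ)) V * Real.exp (-((towerOfAC 𝔎 X 𝔖).mainT (k + 1) h'.1 V) - (towerOfAC 𝔎 X 𝔖).Ecst k
            + ((piecesAC 𝔎 X 𝔖 k).logσ₀ + (piecesAC 𝔎 X 𝔖 k).dg * Real.log ((towerOfAC 𝔎 X 𝔖).g k)) * (piecesAC 𝔎 X 𝔖 k).starB h'.1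
            + (piecesAC 𝔎 X 𝔖 k).logZU h'.1 V + (piecesAC 𝔎 X 𝔖 k).Pold h'.1 V
            + (towerOfAC 𝔎 X 𝔖).Zterm k ((piecesAC 𝔎 X 𝔖 k).proj h'.1) + (towerOfAC 𝔎 X 𝔖).Rm k + (piecesAC 𝔎 X 𝔖 k).logFl h'.1 V))
    hσ hint₀ hm₀0 hle hintW
    (fun h' => measurable_stepWeight _ _ _ _ k h'.1) (fun h' U => stepWeight_nonneg _ _ _ _ k h'.1 U)
    (fun h' U => stepWeight_le_one _ _ _ _ k h'.1 U)
    (fun h' => measurable_chiB _ _ _ k h'.1) (fun h' U => chiB_nonneg _ _ _ k h'.1 U) (fun h' U => chiB_le_one _ _ _ k h'.1 U)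
    (by
      intro h U hm
      have hw : wtP 𝔎 X win k h U ≠ 0 := fun h0 => hm (le_antisymm (h0 ▸ hle h U) (hm₀0 h U))
      have hM : massP 𝔎 X k h U ≠ 0 := fun h0 => hw (le_antisymm (h0 ▸ (wtP_nonneg_le 𝔎 X win k h U).2) (wtP_nonneg_le 𝔎 X win k h U).1)
      have hadm : Hist.Admissible 𝔎.carrier.M₁ (rcolOf S 𝔎.carrier) k h := by
        by_contra hna
        exact hM (massRecP_eq_zero_of_not_admissible _ _ _ _ _ k h U hna)
      obtain ⟨hproj, hone⟩ := stepWeight_mul_chiB_cover 𝔎.carrier.M₁ (rcolOf S 𝔎.carrier) (eps1Of S 𝔎.carrier) (epsSOf S 𝔎.carrier)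
        k hLS h hadm U
      exact ⟨⟨_, hcoverIn h U hm⟩, hproj, hone⟩)
    hdirect
  filter_upwards [key] with V hV
  refine hV.trans ?_
  rw [Finset.sum_coe_sort H₁ (fun h' => massP 𝔎 X (k + 1) h' V *
        ((win k h').indicator (fun _ => (1 : ℝ)) V * Real.exp (-((towerOfAC 𝔎 X 𝔖).mainT (k + 1) h' V) - (towerOfAC 𝔎 X 𝔖).Ecst k
            + ((piecesAC 𝔎 X 𝔖 k).logσ₀ + (piecesAC 𝔎 X 𝔖 k).dg * Real.log ((towerOfAC 𝔎 X 𝔖).g k)) * (piecesAC 𝔎 X 𝔖 k).starB h'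
            + (piecesAC 𝔎 X 𝔖 k).logZU h' V + (piecesAC 𝔎 X 𝔖 k).Pold h' V
            + (towerOfAC 𝔎 X 𝔖).Zterm k ((piecesAC 𝔎 X 𝔖 k).proj h') + (towerOfAC 𝔎 X 𝔖).Rm k + (piecesAC 𝔎 X 𝔖 k).logFl h' V)))]
  refine Finset.sum_le_sum fun h' _ => ?_
  rw [wtP_succ]
  have hM0 := massRecP_nonneg 𝔎.carrier.M₁ (rcolOf S 𝔎.carrier) (eps1Of S 𝔎.carrier) (epsSOf S 𝔎.carrier) X.av (k + 1) h' V
  have hi0 : 0 ≤ (win k h').indicator (fun _ => (1 : ℝ)) V := Set.indicator_nonneg (fun _ _ => zero_le_one) V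
  have hkey : ∀ {m i x y : ℝ}, 0 ≤ m → 0 ≤ i → x ≤ y → m * (i * x) ≤ i * m * y := by
    intro m i x y hm hi hxy
    calc m * (i * x) = i * m * x := by ring
      _ ≤ i * m * y := mul_le_mul_of_nonneg_left hxy (mul_nonneg hi hm)
  exact hkey hM0 hi0 (Real.exp_le_exp.mpr (hexpo h' V))

/-! ## §2 The induction above a base level -/

open Classical in
/-- ★★★ **THE RESTRICTED (41) PROPAGATES UP THE v3 TOWER.**  Base level `b`; densities `σ_k ≥ 0`, integrable, `σ_{k+1} =ᵐ T_k σ_k` for `b ≤ k < K`; a family `Ha k`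
closed under the lane's covering from `b` on (`h ∈ Ha k`, `wtP_k(h,U) ≠ 0` ⟹ `h ⌢ largeSet(h,U) ∈ Ha (k+1)`); the rows, the exponent step and the data rows at every
step; the restricted (41) at level `b`.  THEN the restricted (41) at every `b ≤ k ≤ K` (each step = §1 with `m₀ := 𝟙[h ∈ Ha k]·wtP_k`).
[cite: Balaban1985UV3, (41) p.266 + (48)-(49) pp.267-268 + (55) p.269] -/
theorem restricted41_above (hwin : ∀ k h', MeasurableSet (win k h'))
    (hrow : ∀ k, k + 1 ≤ S.K → ∀ h' : Hist S.P (k + 1), Fibre55WinAC 𝔎 X 𝔖 win k h')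
    (hexpo : ∀ k, k + 1 ≤ S.K → ∀ (hh : Hist S.P (k + 1)) (U : GaugeField S.P (k + 1) G),
      -((towerOfAC 𝔎 X 𝔖).mainT (k + 1) hh U) - (towerOfAC 𝔎 X 𝔖).Ecst k
          + ((piecesAC 𝔎 X 𝔖 k).logσ₀ + (piecesAC 𝔎 X 𝔖 k).dg * Real.log ((towerOfAC 𝔎 X 𝔖).g k)) * (piecesAC 𝔎 X 𝔖 k).starB hh
          + (piecesAC 𝔎 X 𝔖 k).logZU hh U + (piecesAC 𝔎 X 𝔖 k).Pold hh U
          + (towerOfAC 𝔎 X 𝔖).Zterm k ((piecesAC 𝔎 X 𝔖 k).proj hh) + (towerOfAC 𝔎 X 𝔖).Rm k + (piecesAC 𝔎 X 𝔖 k).logFl hh U ≤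
        -((towerOfAC 𝔎 X 𝔖).mainT (k + 1) hh U) + (towerOfAC 𝔎 X 𝔖).Pint (k + 1) hh U - (towerOfAC 𝔎 X 𝔖).Ecst (k + 1)
          + (towerOfAC 𝔎 X 𝔖).Zterm (k + 1) hh + (towerOfAC 𝔎 X 𝔖).Rm (k + 1))
    (hU : ∀ k, k + 1 ≤ S.K → ∀ h : Hist S.P k, Measurable (X.UkH k h))
    (hPm : ∀ k, k + 1 ≤ S.K → ∀ h : Hist S.P k, Measurable ((inputOfAC 𝔎 X 𝔖).Pint k h))
    (hPb : ∀ k, k + 1 ≤ S.K → ∃ cP : ℝ, ∀ (h : Hist S.P k) (U : GaugeField S.P k G), (inputOfAC 𝔎 X 𝔖).Pint k h U ≤ cP)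
    (b : ℕ) (Ha : (k : ℕ) → Finset (Hist S.P k))
    (hHa : ∀ k, b ≤ k → k + 1 ≤ S.K → ∀ h ∈ Ha k, ∀ U : GaugeField S.P k G, wtP 𝔎 X win k h U ≠ 0 →
      Hist.snoc h (largeSet 𝔎.carrier.M₁ (rcolOf S 𝔎.carrier) (eps1Of S 𝔎.carrier) k h U) ∈ Ha (k + 1))
    (σ : (k : ℕ) → Density S.P k G) (hσ0 : ∀ k U, 0 ≤ σ k U) (hσi : ∀ k, Integrable (σ k) (fieldMeasure S.P k G))
    (hσT : ∀ k, b ≤ k → k + 1 ≤ S.K → σ (k + 1) =ᵐ[fieldMeasure S.P (k + 1) G] rnTransport (X.av k).avg (σ k))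
    (hbase : σ b ≤ᵐ[fieldMeasure S.P b G] fun V => ∑ h ∈ Ha b, wtP 𝔎 X win b h V *
      Real.exp (-((towerOfAC 𝔎 X 𝔖).mainT b h V) + (towerOfAC 𝔎 X 𝔖).Pint b h V - (towerOfAC 𝔎 X 𝔖).Ecst b
        + (towerOfAC 𝔎 X 𝔖).Zterm b h + (towerOfAC 𝔎 X 𝔖).Rm b)) :
    ∀ k, b ≤ k → k ≤ S.K → σ k ≤ᵐ[fieldMeasure S.P k G] fun V => ∑ h ∈ Ha k, wtP 𝔎 X win k h V *
      Real.exp (-((towerOfAC 𝔎 X 𝔖).mainT k h V) + (towerOfAC 𝔎 X 𝔖).Pint k h V - (towerOfAC 𝔎 X 𝔖).Ecst k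
        + (towerOfAC 𝔎 X 𝔖).Zterm k h + (towerOfAC 𝔎 X 𝔖).Rm k) := by
  intro k hbk hkK
  induction k, hbk using Nat.le_induction with
  | base => exact hbase
  | succ k hbk ih =>
    have hk : k + 1 ≤ S.K := hkK
    have ih' := ih (by omega)
    set m₀ : Hist S.P k → Density S.P k G := fun h U => if h ∈ Ha k then wtP 𝔎 X win k h U else 0 with hm₀
    have hm₀m : ∀ h, Measurable (m₀ h) := fun h => by
      by_cases hh : h ∈ Ha k
      · have : m₀ h = wtP 𝔎 X win k h := funext fun U => by simp only [hm₀, if_pos hh]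
        rw [this]; exact measurable_wtP 𝔎 X win hwin k h
      · have : m₀ h = fun _ => 0 := funext fun U => by simp only [hm₀, if_neg hh]
        rw [this]; exact measurable_const
    have hm₀0 : ∀ h U, 0 ≤ m₀ h U := fun h U => by
      simp only [hm₀]; split_ifs
      · exact (wtP_nonneg_le 𝔎 X win k h U).1
      · exact le_rfl
    have hle : ∀ h U, m₀ h U ≤ wtP 𝔎 X win k h U := fun h U => by
      simp only [hm₀]; split_ifs
      · exact le_rfl
      · exact (wtP_nonneg_le 𝔎 X win k h U).1
    have hcoverIn : ∀ (h : Hist S.P k) (U : GaugeField S.P k G), m₀ h U ≠ 0 →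
        Hist.snoc h (largeSet 𝔎.carrier.M₁ (rcolOf S 𝔎.carrier) (eps1Of S 𝔎.carrier) k h U) ∈ Ha (k + 1) := fun h U hm => by
      by_cases hh : h ∈ Ha k
      · simp only [hm₀, if_pos hh] at hm
        exact hHa k hbk hk h hh U hm
      · simp only [hm₀, if_neg hh] at hm
        exact absurd rfl hm
    have hσ : σ k ≤ᵐ[fieldMeasure S.P k G] fun U => ∑ h : Hist S.P k, m₀ h U *
        Real.exp (-((towerOfAC 𝔎 X 𝔖).mainT k h U) + (towerOfAC 𝔎 X 𝔖).Pint k h U - (towerOfAC 𝔎 X 𝔖).Ecst k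
          + (towerOfAC 𝔎 X 𝔖).Zterm k h + (towerOfAC 𝔎 X 𝔖).Rm k) := by
      filter_upwards [ih'] with U hUle
      refine hUle.trans (le_of_eq ?_)
      rw [← Finset.sum_filter_add_sum_filter_not Finset.univ (fun h => h ∈ Ha k)]
      have hset : Finset.univ.filter (fun h => h ∈ Ha k) = Ha k := by ext h; simp
      have h2 : ∑ h ∈ Finset.univ.filter (fun h => ¬ h ∈ Ha k), m₀ h U *
          Real.exp (-((towerOfAC 𝔎 X 𝔖).mainT k h U) + (towerOfAC 𝔎 X 𝔖).Pint k h U - (towerOfAC 𝔎 X 𝔖).Ecst k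
            + (towerOfAC 𝔎 X 𝔖).Zterm k h + (towerOfAC 𝔎 X 𝔖).Rm k) = 0 := by
        refine Finset.sum_eq_zero fun h hh => ?_
        rw [Finset.mem_filter] at hh
        simp only [hm₀, if_neg hh.2, zero_mul]
      rw [hset, h2, add_zero]
      exact Finset.sum_congr rfl fun h hh => by simp only [hm₀, if_pos hh]
    have step := transport_restricted_le_sum41_ae 𝔎 X 𝔖 win hwin k hk (hrow k hk) (hexpo k hk) (hU k hk) (hPm k hk) (hPb k hk)
      m₀ hm₀m hm₀0 hle (Ha (k + 1)) hcoverIn (σ k) (hσ0 k) (hσi k) hσ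
    filter_upwards [hσT k hbk hk, step] with W hW hs
    rw [hW]
    exact hs

/-! ## §3 The pin level -/

open Classical in
/-- ★★★ **THE PIN LEVEL FOR THE v3 TOWER.**  Pinned level `s`, `s + 1 ≤ K`; the v3 (41)_s a.e. with the windowed weights (`h41s`, the package's
`PkgCoreV3.ineq41P_ae`); the rows∕exponent step∕data rows at step `s`; a measurable event `A` of level-`s` fields; a family `H₁` containing the covering history of every
`(h,U)` with `U ∈ A`, `wtP_s(h,U) ≠ 0`; `σ ≥ 0` integrable with `σ ≤ᵐ 𝟙_A·ρ_s`.  THEN `T_s σ ≤ᵐ Σ_{h′ ∈ H₁} wtP_{s+1}(h′)·e^{(41)_{s+1}}`.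
[cite: Balaban1985UV3, (7)-(8) pp.257-258 + (41) p.266 + (48)-(49) pp.267-268] -/
theorem restricted41_succ_of_pin (hwin : ∀ k h', MeasurableSet (win k h')) (s : ℕ) (hs : s + 1 ≤ S.K)
    (h41s : ∀ᵐ V ∂(fieldMeasure S.P s G), (towerOfAC 𝔎 X 𝔖).ρ s V ≤
      ∑ h : Hist S.P s, wtP 𝔎 X win s h V *
        Real.exp (-((towerOfAC 𝔎 X 𝔖).mainT s h V) + (towerOfAC 𝔎 X 𝔖).Pint s h V - (towerOfAC 𝔎 X 𝔖).Ecst s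
          + (towerOfAC 𝔎 X 𝔖).Zterm s h + (towerOfAC 𝔎 X 𝔖).Rm s))
    (hrow : ∀ h' : Hist S.P (s + 1), Fibre55WinAC 𝔎 X 𝔖 win s h')
    (hexpo : ∀ (hh : Hist S.P (s + 1)) (U : GaugeField S.P (s + 1) G),
      -((towerOfAC 𝔎 X 𝔖).mainT (s + 1) hh U) - (towerOfAC 𝔎 X 𝔖).Ecst s
          + ((piecesAC 𝔎 X 𝔖 s).logσ₀ + (piecesAC 𝔎 X 𝔖 s).dg * Real.log ((towerOfAC 𝔎 X 𝔖).g s)) * (piecesAC 𝔎 X 𝔖 s).starB hh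
          + (piecesAC 𝔎 X 𝔖 s).logZU hh U + (piecesAC 𝔎 X 𝔖 s).Pold hh U
          + (towerOfAC 𝔎 X 𝔖).Zterm s ((piecesAC 𝔎 X 𝔖 s).proj hh) + (towerOfAC 𝔎 X 𝔖).Rm s + (piecesAC 𝔎 X 𝔖 s).logFl hh U ≤
        -((towerOfAC 𝔎 X 𝔖).mainT (s + 1) hh U) + (towerOfAC 𝔎 X 𝔖).Pint (s + 1) hh U - (towerOfAC 𝔎 X 𝔖).Ecst (s + 1)
          + (towerOfAC 𝔎 X 𝔖).Zterm (s + 1) hh + (towerOfAC 𝔎 X 𝔖).Rm (s + 1))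
    (hU : ∀ h : Hist S.P s, Measurable (X.UkH s h))
    (hPm : ∀ h : Hist S.P s, Measurable ((inputOfAC 𝔎 X 𝔖).Pint s h))
    (hPb : ∃ cP : ℝ, ∀ (h : Hist S.P s) (U : GaugeField S.P s G), (inputOfAC 𝔎 X 𝔖).Pint s h U ≤ cP)
    (A : Set (GaugeField S.P s G)) (hA : MeasurableSet A)
    (H₁ : Finset (Hist S.P (s + 1)))
    (hcoverIn : ∀ (h : Hist S.P s) (U : GaugeField S.P s G), U ∈ A → wtP 𝔎 X win s h U ≠ 0 →
      Hist.snoc h (largeSet 𝔎.carrier.M₁ (rcolOf S 𝔎.carrier) (eps1Of S 𝔎.carrier) s h U) ∈ H₁)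
    (σ : Density S.P s G) (hσ0 : ∀ U, 0 ≤ σ U) (hσi : Integrable σ (fieldMeasure S.P s G))
    (hσ : σ ≤ᵐ[fieldMeasure S.P s G] fun U => A.indicator (fun _ => (1 : ℝ)) U * (towerOfAC 𝔎 X 𝔖).ρ s U) :
    rnTransport (X.av s).avg σ ≤ᵐ[fieldMeasure S.P (s + 1) G] fun V =>
      ∑ h' ∈ H₁, wtP 𝔎 X win (s + 1) h' V *
        Real.exp (-((towerOfAC 𝔎 X 𝔖).mainT (s + 1) h' V) + (towerOfAC 𝔎 X 𝔖).Pint (s + 1) h' V - (towerOfAC 𝔎 X 𝔖).Ecst (s + 1)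
          + (towerOfAC 𝔎 X 𝔖).Zterm (s + 1) h' + (towerOfAC 𝔎 X 𝔖).Rm (s + 1)) := by
  set m₀ : Hist S.P s → Density S.P s G := fun h U => A.indicator (fun _ => (1 : ℝ)) U * wtP 𝔎 X win s h U with hm₀
  have hind01 : ∀ U, 0 ≤ A.indicator (fun _ => (1 : ℝ)) U ∧ A.indicator (fun _ => (1 : ℝ)) U ≤ 1 := fun U => by
    by_cases hU : U ∈ A
    · rw [Set.indicator_of_mem hU]; exact ⟨zero_le_one, le_rfl⟩
    · rw [Set.indicator_of_notMem hU]; exact ⟨le_rfl, zero_le_one⟩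
  have hm₀m : ∀ h, Measurable (m₀ h) := fun h => (measurable_const.indicator hA).mul (measurable_wtP 𝔎 X win hwin s h)
  have hm₀0 : ∀ h U, 0 ≤ m₀ h U := fun h U => mul_nonneg (hind01 U).1 (wtP_nonneg_le 𝔎 X win s h U).1
  have hle : ∀ h U, m₀ h U ≤ wtP 𝔎 X win s h U := fun h U => by
    calc m₀ h U ≤ 1 * wtP 𝔎 X win s h U := mul_le_mul_of_nonneg_right (hind01 U).2 (wtP_nonneg_le 𝔎 X win s h U).1
      _ = _ := one_mul _
  have hcover' : ∀ (h : Hist S.P s) (U : GaugeField S.P s G), m₀ h U ≠ 0 →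
      Hist.snoc h (largeSet 𝔎.carrier.M₁ (rcolOf S 𝔎.carrier) (eps1Of S 𝔎.carrier) s h U) ∈ H₁ := fun h U hm => by
    by_cases hU : U ∈ A
    · refine hcoverIn h U hU fun h0 => hm ?_
      simp only [hm₀, h0, mul_zero]
    · exact absurd (by simp only [hm₀, Set.indicator_of_notMem hU, zero_mul]) hm
  have hσ' : σ ≤ᵐ[fieldMeasure S.P s G] fun U => ∑ h : Hist S.P s, m₀ h U *
      Real.exp (-((towerOfAC 𝔎 X 𝔖).mainT s h U) + (towerOfAC 𝔎 X 𝔖).Pint s h U - (towerOfAC 𝔎 X 𝔖).Ecst s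
        + (towerOfAC 𝔎 X 𝔖).Zterm s h + (towerOfAC 𝔎 X 𝔖).Rm s) := by
    filter_upwards [hσ, h41s] with U hU h41
    refine hU.trans ?_
    have hsum : (∑ h : Hist S.P s, m₀ h U *
        Real.exp (-((towerOfAC 𝔎 X 𝔖).mainT s h U) + (towerOfAC 𝔎 X 𝔖).Pint s h U - (towerOfAC 𝔎 X 𝔖).Ecst s
          + (towerOfAC 𝔎 X 𝔖).Zterm s h + (towerOfAC 𝔎 X 𝔖).Rm s))
        = A.indicator (fun _ => (1 : ℝ)) U * ∑ h : Hist S.P s, wtP 𝔎 X win s h U *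
        Real.exp (-((towerOfAC 𝔎 X 𝔖).mainT s h U) + (towerOfAC 𝔎 X 𝔖).Pint s h U - (towerOfAC 𝔎 X 𝔖).Ecst s
          + (towerOfAC 𝔎 X 𝔖).Zterm s h + (towerOfAC 𝔎 X 𝔖).Rm s) := by
      rw [Finset.mul_sum]
      refine Finset.sum_congr rfl fun h _ => ?_
      simp only [hm₀]
      ring
    rw [hsum]
    exact mul_le_mul_of_nonneg_left h41 (hind01 U).1
  exact transport_restricted_le_sum41_ae 𝔎 X 𝔖 win hwin s hs hrow hexpo hU hPm hPb m₀ hm₀m hm₀0 hle H₁ hcover' σ hσ0 hσi hσ'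

/-! ## §4 The explicit pinned family -/

open Classical in
/-- ★★★ **THE PINNED (41) ABOVE THE PIN FOR THE v3 TOWER, EXPLICIT FAMILY.**  From `σ_s ≤ᵐ 𝟙{θ ≤ dist1 U(∂a)}·ρ_s` with `eps1Of s ≤ θ`, the v3 (41)_s a.e., the
rows∕exponent step∕data rows at every step, and `σ_{k+1} =ᵐ T_k σ_k` above `s`: at every `s + 1 ≤ k ≤ K`,
`σ_k ≤ᵐ Σ_{h : a ∈ h(s) ∨ ¬ plaqCover a ⊆ Ω_s(h↾s)} wtP_k(h)·exp[(41)_k exponent]`. [cite: Balaban1985UV3, (7)-(8) pp.257-258 + (41) p.266 + (48)-(49) pp.267-268] -/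
theorem pinned41_above (hwin : ∀ k h', MeasurableSet (win k h'))
    (hrow : ∀ k, k + 1 ≤ S.K → ∀ h' : Hist S.P (k + 1), Fibre55WinAC 𝔎 X 𝔖 win k h')
    (hexpo : ∀ k, k + 1 ≤ S.K → ∀ (hh : Hist S.P (k + 1)) (U : GaugeField S.P (k + 1) G),
      -((towerOfAC 𝔎 X 𝔖).mainT (k + 1) hh U) - (towerOfAC 𝔎 X 𝔖).Ecst k
          + ((piecesAC 𝔎 X 𝔖 k).logσ₀ + (piecesAC 𝔎 X 𝔖 k).dg * Real.log ((towerOfAC 𝔎 X 𝔖).g k)) * (piecesAC 𝔎 X 𝔖 k).starB hh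
          + (piecesAC 𝔎 X 𝔖 k).logZU hh U + (piecesAC 𝔎 X 𝔖 k).Pold hh U
          + (towerOfAC 𝔎 X 𝔖).Zterm k ((piecesAC 𝔎 X 𝔖 k).proj hh) + (towerOfAC 𝔎 X 𝔖).Rm k + (piecesAC 𝔎 X 𝔖 k).logFl hh U ≤
        -((towerOfAC 𝔎 X 𝔖).mainT (k + 1) hh U) + (towerOfAC 𝔎 X 𝔖).Pint (k + 1) hh U - (towerOfAC 𝔎 X 𝔖).Ecst (k + 1)
          + (towerOfAC 𝔎 X 𝔖).Zterm (k + 1) hh + (towerOfAC 𝔎 X 𝔖).Rm (k + 1))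
    (hU : ∀ k, k + 1 ≤ S.K → ∀ h : Hist S.P k, Measurable (X.UkH k h))
    (hPm : ∀ k, k + 1 ≤ S.K → ∀ h : Hist S.P k, Measurable ((inputOfAC 𝔎 X 𝔖).Pint k h))
    (hPb : ∀ k, k + 1 ≤ S.K → ∃ cP : ℝ, ∀ (h : Hist S.P k) (U : GaugeField S.P k G), (inputOfAC 𝔎 X 𝔖).Pint k h U ≤ cP)
    (s : ℕ) (hs : s + 1 ≤ S.K) (a : Plaq S.P s) (θ : ℝ) (hθ : eps1Of S 𝔎.carrier s ≤ θ)
    (h41s : ∀ᵐ V ∂(fieldMeasure S.P s G), (towerOfAC 𝔎 X 𝔖).ρ s V ≤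
      ∑ h : Hist S.P s, wtP 𝔎 X win s h V *
        Real.exp (-((towerOfAC 𝔎 X 𝔖).mainT s h V) + (towerOfAC 𝔎 X 𝔖).Pint s h V - (towerOfAC 𝔎 X 𝔖).Ecst s
          + (towerOfAC 𝔎 X 𝔖).Zterm s h + (towerOfAC 𝔎 X 𝔖).Rm s))
    (σ : (k : ℕ) → Density S.P k G) (hσ0 : ∀ k U, 0 ≤ σ k U) (hσi : ∀ k, Integrable (σ k) (fieldMeasure S.P k G))
    (hσT : ∀ k, s ≤ k → k + 1 ≤ S.K → σ (k + 1) =ᵐ[fieldMeasure S.P (k + 1) G] rnTransport (X.av k).avg (σ k))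
    (hσs : σ s ≤ᵐ[fieldMeasure S.P s G] fun U =>
      {U : GaugeField S.P s G | θ ≤ dist1 (GaugeField.plaqHol U a)}.indicator (fun _ => (1 : ℝ)) U * (towerOfAC 𝔎 X 𝔖).ρ s U) :
    ∀ (k : ℕ) (hsk : s + 1 ≤ k), k ≤ S.K → σ k ≤ᵐ[fieldMeasure S.P k G] fun W =>
      ∑ h ∈ Finset.univ.filter (fun h : Hist S.P k =>
          a ∈ h ⟨s, hsk⟩ ∨ ¬ plaqCover a ⊆ Omega 𝔎.carrier.M₁ (rcolOf S 𝔎.carrier) s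
            (fun j : Fin s => h (Fin.castLE (Nat.le_of_succ_le hsk) j)) s),
        wtP 𝔎 X win k h W *
          Real.exp (-((towerOfAC 𝔎 X 𝔖).mainT k h W) + (towerOfAC 𝔎 X 𝔖).Pint k h W - (towerOfAC 𝔎 X 𝔖).Ecst k
            + (towerOfAC 𝔎 X 𝔖).Zterm k h + (towerOfAC 𝔎 X 𝔖).Rm k) := by
  let Ha : (k : ℕ) → Finset (Hist S.P k) := fun k =>
    if hsk : s + 1 ≤ k then
      Finset.univ.filter (fun h : Hist S.P k =>
        a ∈ h ⟨s, hsk⟩ ∨ ¬ plaqCover a ⊆ Omega 𝔎.carrier.M₁ (rcolOf S 𝔎.carrier) s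
          (fun j : Fin s => h (Fin.castLE (Nat.le_of_succ_le hsk) j)) s)
    else ∅
  have hHa_eq : ∀ (k : ℕ) (hsk : s + 1 ≤ k), Ha k = Finset.univ.filter (fun h : Hist S.P k =>
        a ∈ h ⟨s, hsk⟩ ∨ ¬ plaqCover a ⊆ Omega 𝔎.carrier.M₁ (rcolOf S 𝔎.carrier) s
          (fun j : Fin s => h (Fin.castLE (Nat.le_of_succ_le hsk) j)) s) := fun k hsk => by
    simp only [Ha, dif_pos hsk]
  have hHa : ∀ k, s + 1 ≤ k → k + 1 ≤ S.K → ∀ h ∈ Ha k, ∀ U : GaugeField S.P k G, wtP 𝔎 X win k h U ≠ 0 →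
      Hist.snoc h (largeSet 𝔎.carrier.M₁ (rcolOf S 𝔎.carrier) (eps1Of S 𝔎.carrier) k h U) ∈ Ha (k + 1) := by
    intro k hsk _ h hh U _
    rw [hHa_eq k hsk, Finset.mem_filter] at hh
    rw [hHa_eq (k + 1) (by omega), Finset.mem_filter]
    exact ⟨Finset.mem_univ _, (pinFamily_snoc_iff 𝔎.carrier.M₁ (rcolOf S 𝔎.carrier) hsk a h _).mpr hh.2⟩
  have hA : MeasurableSet {U : GaugeField S.P s G | θ ≤ dist1 (GaugeField.plaqHol U a)} :=
    measurableSet_le measurable_const (measurable_dev a)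
  have hbase : σ (s + 1) ≤ᵐ[fieldMeasure S.P (s + 1) G] fun W => ∑ h ∈ Ha (s + 1), wtP 𝔎 X win (s + 1) h W *
      Real.exp (-((towerOfAC 𝔎 X 𝔖).mainT (s + 1) h W) + (towerOfAC 𝔎 X 𝔖).Pint (s + 1) h W - (towerOfAC 𝔎 X 𝔖).Ecst (s + 1)
        + (towerOfAC 𝔎 X 𝔖).Zterm (s + 1) h + (towerOfAC 𝔎 X 𝔖).Rm (s + 1)) := by
    have hpin := restricted41_succ_of_pin 𝔎 X 𝔖 win hwin s hs h41s (hrow s hs) (hexpo s hs) (hU s hs) (hPm s hs) (hPb s hs)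
      {U : GaugeField S.P s G | θ ≤ dist1 (GaugeField.plaqHol U a)} hA (Ha (s + 1))
      (fun h U hU hw => by
        rw [hHa_eq (s + 1) le_rfl, Finset.mem_filter]
        exact ⟨Finset.mem_univ _, mem_pinFamily_snoc_of_pin 𝔎.carrier.M₁ (rcolOf S 𝔎.carrier) (eps1Of S 𝔎.carrier) a h U hθ hU⟩)
      (σ s) (hσ0 s) (hσi s) hσs
    filter_upwards [hσT s le_rfl hs, hpin] with W hW hp
    rw [hW]
    exact hp
  intro k hsk hkK
  have hmain := restricted41_above 𝔎 X 𝔖 win hwin hrow hexpo hU hPm hPb (s + 1) Ha (fun k hk hk1 => hHa k hk hk1) σ hσ0 hσi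
    (fun k hk hk1 => hσT k (by omega) hk1) hbase k hsk hkK
  rw [hHa_eq k hsk] at hmain
  exact hmain

end Summit.QuantumFields.YangMills.Theorems.UV3PinnedRestrictedStepV3

end
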